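import Summits.BirchSwinnertonDyer.BirchSwinnertonDyer.Theorems.GenusKolyvaginAtTwoMinimalTwinBSDTwoOddCutDepthZeroFrame
import Summits.BirchSwinnertonDyer.BirchSwinnertonDyer.Theorems.GenusKolyvaginAtTwoPowDvdShaCardAtTwoRTGenusBudgetPrimeDisc
import Summits.BirchSwinnertonDyer.BirchSwinnertonDyer.Theorems.GenusKolyvaginAtTwoMinimalTwinBSDTwoSwappedPairSilentPrime
import HarnessLib

/-!
# Route `GenusKolyvaginAtTwo`, crux U₂ `MinimalTwinBSDTwo` (stmt-BirchSwinnertonDyer-22985), LINE 23 «twin_swap» — PRIME FRAMES OF THE ODD HABITAT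
# CUT: at a prime Heegner discriminant `d_K = −ℓ₀` the genus budget is AUTOMATIC (`Δ < 0`: one bit; `Δ > 0` and the `2`-division cubic rootless
# mod `ℓ₀`: zero bits), so the analytic leaf FRAME^± follows from a PRIME-TWIST statement «a Heegner prime `ℓ₀` (silent when `Δ > 0`) with
# `y_K` non-torsion and an odd-`c` datum»

Seat `bsd-line-gk2-p2` g32 (PROVER seat 2/3, cell `bsd-f1-sign2`, LINE 23 holder), `--supports stmt-BirchSwinnertonDyer-22985 --as helper`.
THEOREMS ONLY (no definition, no named fact, no `sorry`).  BSD is NOT proved by any of this; U₂ is NOT proved; nothing is closed.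

WHY (REF1 §428 R428a/R428b: the frame supply FRAME^± of LINE 23 v2.8 — one odd Heegner frame inside the genus budget
`(Δ_W < 0 ∧ ord₂ C(Wd) ≤ 1) ∨ ord₂ C(Wd) = 0` with `P(1)` non-torsion and an odd-`c` datum — is the line's ANALYTIC research leaf; its placement row
asks «which print gives a Heegner `d_K` with the budget and `y_K` non-torsion»).  At PRIME frames the budget clause DISAPPEARS into the tree's genus
bookkeeping: on `Δ < 0`, `ord₂ C(Wd) = 1` for every prime Heegner `d_K` (gk2-p3, `PlusDescent.padicValNat_two_tamagawaProduct_twin_eq_one_of_prime` —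
the ramified prime is a transposition prime); on `Δ > 0`, `ord₂ C(Wd) = ord₂ C(W) = 0` as soon as the `2`-division cubic of the integral minimal model has
no root mod `ℓ₀` (gk2-p3, `TwinSwap.Silent.padicValNat_two_tamagawaProduct_twin_eq_of_discr_eq_neg_prime_of_noRoot`).  A globally minimal twin model
always exists (`hasGlobalMinimalModel_rat_holds`).  So FRAME^± ⟸ PRIME-FRAME^±: «for every `W` on the cut a Heegner PRIME `ℓ₀ ≠ 3` (`d_K = −ℓ₀`), with
the cubic rootless mod `ℓ₀` when `Δ_W > 0`, an odd-`c` datum and `P(1)` of infinite order» — a prime-twist non-vanishing statement with one Frobenius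
condition (Ono–Skinner / Kriz–Li currency), which is what REF2 is asked to place.

* §1 `genusBudget_of_primeFrame` — the budget clause at a prime frame, either sign (`Δ < 0`, or cubic rootless mod `ℓ₀`).
* §2 `exists_twinModel_inBudget_of_primeFrame` — a globally minimal twin model inside the budget at a prime frame.
* §3 `minimalTwinBSDTwo_onOddCut_of_wall_of_primeFrameSupply_of_facts` — **U₂ on the WHOLE odd habitat cut ⟸ WALL row 1 + PRINT + Q2 +
  PRIME-FRAME^± + WITNESS** in one displayed `∀∃` (per `W`: a Heegner prime frame as above, odd-`c` datum, `P(1)` non-torsion with exact depth `M₀`,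
  and — only needed when `M₀ ≥ 1`, trivially `(1, d₁)` at depth `0` by p812083 — a transposition-deep witness), via p811686 §4.

References: [Kramer1981] §2 Prop. 3; [GrossLMS1991] §1, §3; [MazurRubin2010] Lemma 2.2 (i), Cor. 3.4 (i); [Kolyvagin1989Izv] Thm. B_l;
[OnoSkinner1998] (prime-twist non-vanishing, the nearest print to PRIME-FRAME^±).
-/

set_option autoImplicit false
set_option linter.dupNamespace false -- `Summit.<P>.<Sub>` repeats `BirchSwinnertonDyer` (D-0017)

noncomputable section

open scoped Classical

namespace Summit.BirchSwinnertonDyer.BirchSwinnertonDyer.Theorems.GenusExact.TwinSwap.TwinAnnihilation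

open Literature.NumberTheory.EllipticCurves Literature.NumberTheory.GaloisRepresentations WeierstrassCurve NumberField
  IsDedekindDomain Field AddSubgroup Literature.NumberTheory.EllipticCurves.ModularForms
open Summit.BirchSwinnertonDyer.Rank1Residual
open Summit.BirchSwinnertonDyer.BirchSwinnertonDyer.Theses.GenusKolyvaginAtTwo (KolyvaginRelationAtTwo)
open Summit.BirchSwinnertonDyer.BirchSwinnertonDyer.Theorems.GenusExact.PlusDescent (padicValNat_two_tamagawaProduct_twin_eq_one_of_prime)
open Summit.BirchSwinnertonDyer.BirchSwinnertonDyer.Theorems.GenusExact.TwinSwap.Silent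
  (padicValNat_two_tamagawaProduct_twin_eq_of_discr_eq_neg_prime_of_noRoot)

/-! ## §1 The genus budget at a prime frame, either sign -/

/-- **The genus budget is automatic at a PRIME Heegner frame**: `W/ℚ` globally minimal with `C(W)` odd, `K` imaginary quadratic with `d_K = −ℓ₀`
(`ℓ₀` prime), `d_K` odd, Heegner for `N_W`, `Wd = Cd • W^{(d_K)}` elliptic; if `Δ_W < 0`, or the `2`-division cubic of the integral minimal model has
no root mod `ℓ₀`, then `(Δ_W < 0 ∧ ord₂ C(Wd) ≤ 1) ∨ ord₂ C(Wd) = 0`.  (`Δ < 0`: the ramified prime is a transposition prime, one bit; rootless: the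
ramified prime is silent, zero bits.)  [cite: Kramer1981, §2 Prop. 3] [cite: MazurRubin2010, Lemma 2.2 (i)] -/
theorem genusBudget_of_primeFrame (W : WeierstrassCurve ℚ) [W.IsElliptic] [W.IsGloballyMinimal] (hT : Odd W.tamagawaProduct)
    {K : Type} [Field K] [NumberField K] (hK : IsImaginaryQuadratic K) (hodd : Odd (NumberField.discr K))
    (hH : SatisfiesHeegnerHypothesis (W.conductorNorm ℤ) K) {ℓ₀ : ℕ} (hℓ₀ : ℓ₀.Prime) (hd : NumberField.discr K = -(ℓ₀ : ℤ))
    (hframe : W.Δ < 0 ∨ ∀ x : ZMod ℓ₀, 4 * x ^ 3 + ((integralModelInt W).b₂ : ZMod ℓ₀) * x ^ 2 +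
      2 * ((integralModelInt W).b₄ : ZMod ℓ₀) * x + ((integralModelInt W).b₆ : ZMod ℓ₀) ≠ 0)
    {Wd : WeierstrassCurve ℚ} [Wd.IsElliptic] (Cd : VariableChange ℚ) (hWd : Cd • W.quadraticTwist (NumberField.discr K : ℚ) = Wd) :
    (W.Δ < 0 ∧ padicValNat 2 Wd.tamagawaProduct ≤ 1) ∨ padicValNat 2 Wd.tamagawaProduct = 0 := by
  rcases hframe with hneg | hnoRoot
  · have hprime : (NumberField.discr K).natAbs.Prime := by
      rw [hd, Int.natAbs_neg, Int.natAbs_natCast]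
      exact hℓ₀
    exact Or.inl ⟨hneg, (padicValNat_two_tamagawaProduct_twin_eq_one_of_prime W hK hodd hH hT hneg hprime Cd hWd).le⟩
  · haveI : Fact (Nat.Prime 2) := ⟨Nat.prime_two⟩
    have hW0 : padicValNat 2 W.tamagawaProduct = 0 :=
      padicValNat.eq_zero_of_not_dvd fun h ↦ (Nat.not_even_iff_odd.mpr hT) (even_iff_two_dvd.mpr h)
    exact Or.inr ((padicValNat_two_tamagawaProduct_twin_eq_of_discr_eq_neg_prime_of_noRoot W hK hodd hH hℓ₀ hd hnoRoot Cd hWd).trans hW0)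

/-! ## §2 A globally minimal twin model inside the budget at a prime frame -/

/-- **At a PRIME Heegner frame there is a globally minimal twin model inside the genus budget** (§1 + `hasGlobalMinimalModel_rat_holds`): the twin
clause of FRAME^± (`OddCutFrameSupplyAtTwo` of LINE 23 v2.8) needs no choice at prime frames. [cite: Kramer1981, §2 Prop. 3]
[cite: SilvermanAEC2009, VIII.8] -/
theorem exists_twinModel_inBudget_of_primeFrame (W : WeierstrassCurve ℚ) [W.IsElliptic] [W.IsGloballyMinimal] (hT : Odd W.tamagawaProduct)
    {K : Type} [Field K] [NumberField K] (hK : IsImaginaryQuadratic K) (hodd : Odd (NumberField.discr K))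
    (hH : SatisfiesHeegnerHypothesis (W.conductorNorm ℤ) K) {ℓ₀ : ℕ} (hℓ₀ : ℓ₀.Prime) (hd : NumberField.discr K = -(ℓ₀ : ℤ))
    (hframe : W.Δ < 0 ∨ ∀ x : ZMod ℓ₀, 4 * x ^ 3 + ((integralModelInt W).b₂ : ZMod ℓ₀) * x ^ 2 +
      2 * ((integralModelInt W).b₄ : ZMod ℓ₀) * x + ((integralModelInt W).b₆ : ZMod ℓ₀) ≠ 0) :
    ∃ (Wd : WeierstrassCurve ℚ) (_ : Wd.IsElliptic) (_ : Wd.IsGloballyMinimal),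
      (∃ C : VariableChange ℚ, C • W.quadraticTwist (NumberField.discr K : ℚ) = Wd) ∧
        ((W.Δ < 0 ∧ padicValNat 2 Wd.tamagawaProduct ≤ 1) ∨ padicValNat 2 Wd.tamagawaProduct = 0) := by
  have hD0 : (NumberField.discr K : ℚ) ≠ 0 := by exact_mod_cast NumberField.discr_ne_zero K
  haveI hTell : (W.quadraticTwist (NumberField.discr K : ℚ)).IsElliptic := W.isElliptic_quadraticTwist hD0
  obtain ⟨Cd, hmin⟩ := hasGlobalMinimalModel_rat_holds (W.quadraticTwist (NumberField.discr K : ℚ))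
  exact ⟨Cd • W.quadraticTwist (NumberField.discr K : ℚ), inferInstance, hmin, ⟨Cd, rfl⟩,
    genusBudget_of_primeFrame W hT hK hodd hH hℓ₀ hd hframe Cd rfl⟩

/-! ## §3 U₂ on the cut from WALL row 1 + PRINT + Q2 + a prime-frame supply -/

/-- **U₂ ON THE WHOLE ODD HABITAT CUT ⟸ WALL row 1 + PRINT + Q2 + PRIME-FRAME SUPPLY.**  Displayed hypotheses: S1′; the four PRINT facts; Q2; and
the supply: for every `W` on the cut (non-CM, `r_an = 1`, `#Sel₂ = 2`, `C(W)` odd, `ρ_{W,2^∞}` onto, an odd multiplicative prime) a PRIME Heegner frame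
`K`, `d_K = −ℓ₀` (`ℓ₀` prime, `d_K` odd `≠ −3`, Heegner), with `Δ_W < 0` OR the `2`-division cubic rootless mod `ℓ₀`; an odd-`c` datum; a conductor-`1`
datum whose `P(1)` has infinite order and exact depth `M₀`; and a transposition-deep witness (`(1, d₁)` when `M₀ = 0`, p812083).  The twin model and its
budget come from §2; then p811686 §4.  CONDITIONAL; the supply is OPEN (prime-twist non-vanishing with one Frobenius condition + odd Manin constant +
Kolyvagin's conjecture at `2` at positive depth); closes nothing; BSD is NOT proved.
[cite: Kolyvagin1989Izv, Thm. A, Thm. B_l] [cite: Kramer1981, §2 Prop. 3] [cite: GrossZagier1986, V.§2 (2.2)] -/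
theorem minimalTwinBSDTwo_onOddCut_of_wall_of_primeFrameSupply_of_facts (hQ2 : KolyvaginRelationAtTwo)
    (hGZ : ∀ (N : ℕ) [NeZero N] (W : WeierstrassCurve ℚ) (K : Type) [Field K] [NumberField K], gross_zagier N W K)
    (hGZK : rank_eq_analyticRank_of_analyticRank_le_one) (hmod : hasEntireLFunction_rat)
    (hMilneC : Milne1972.bsdQuotient_baseChange_quadratic_anyModel)
    (hS1 : ∀ (W : WeierstrassCurve ℚ) [W.IsElliptic] [W.IsGloballyMinimal], ¬ W.HasCM → W.analyticRank = 0 → BSDp W 2)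
    (hSupplyP : ∀ (W : WeierstrassCurve ℚ) [W.IsElliptic] [W.IsGloballyMinimal] [NeZero (W.conductorNorm ℤ)],
      ¬ W.HasCM → W.analyticRank = 1 → Nat.card (W.selmerGroup 2) = 2 → Odd W.tamagawaProduct →
      (∀ n : ℕ, 0 < n → W.HasSurjectiveModNGaloisRep ((2 : ℤ) ^ n)) →
      (∃ v : HeightOneSpectrum (𝓞 ℚ), ((2 : ℕ) : 𝓞 ℚ) ∉ v.asIdeal ∧ ((W.conductorNorm ℤ : ℕ) : 𝓞 ℚ) ∈ v.asIdeal ∧ W.HasMultiplicativeReductionAt v) →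
      ∃ (K : Type) (_ : Field K) (_ : NumberField K) (ℓ₀ : ℕ), IsImaginaryQuadratic K ∧ Odd (NumberField.discr K) ∧ NumberField.discr K ≠ -3 ∧
        SatisfiesHeegnerHypothesis (W.conductorNorm ℤ) K ∧ ℓ₀.Prime ∧ NumberField.discr K = -(ℓ₀ : ℤ) ∧
        (W.Δ < 0 ∨ ∀ x : ZMod ℓ₀, 4 * x ^ 3 + ((integralModelInt W).b₂ : ZMod ℓ₀) * x ^ 2 +
          2 * ((integralModelInt W).b₄ : ZMod ℓ₀) * x + ((integralModelInt W).b₆ : ZMod ℓ₀) ≠ 0) ∧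
        ∃ (Dt : ModularParametrizationData W (W.conductorNorm ℤ)) (β : ℤ) (ι : K →+* ℂ) (d₁ : KolyvaginHeegnerData Dt β ι 1) (M₀ : ℕ),
          Odd Dt.c ∧ ¬ IsOfFinAddOrder d₁.derivedPoint ∧
          (∃ Q : (W.baseChange (ringClassField K ι 1)).toAffine.Point, ((2 ^ M₀ : ℕ) : ℤ) • Q = d₁.derivedPoint) ∧
          (¬ ∃ Q : (W.baseChange (ringClassField K ι 1)).toAffine.Point, ((2 ^ (M₀ + 1) : ℕ) : ℤ) • Q = d₁.derivedPoint) ∧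
          ∃ (n : ℕ) (d : KolyvaginHeegnerData Dt β ι n), Squarefree n ∧
            (∀ ℓ ∈ n.primeFactors, Zhang2014.IsKolyvaginPrime (W.conductorNorm ℤ) W K 2 ℓ ∧ 2 ≤ Zhang2014.kolyvaginIndex W 2 ℓ ∧
              ∃ (v : HeightOneSpectrum (𝓞 ℚ)) (𝔓 : Ideal (absIntegers (𝓞 ℚ) ℚ)) (h : absoluteGaloisGroup ℚ),
                ((ℓ : ℕ) : 𝓞 ℚ) ∈ v.asIdeal ∧ 𝔓 ∈ v.primesAbove ∧ IsArithFrobAt (𝓞 ℚ) h 𝔓 ∧ ∃ u : W.geomTorsion ((2 : ℕ) : ℤ), h • u ≠ u) ∧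
            ¬ ∃ Q : (W.baseChange (ringClassField K ι n)).toAffine.Point, (2 : ℤ) • Q = d.derivedPoint) :
    ∀ (W : WeierstrassCurve ℚ) [W.IsElliptic] [W.IsGloballyMinimal] [NeZero (W.conductorNorm ℤ)],
      ¬ W.HasCM → W.analyticRank = 1 → Nat.card (W.selmerGroup 2) = 2 → Odd W.tamagawaProduct →
      (∀ n : ℕ, 0 < n → W.HasSurjectiveModNGaloisRep ((2 : ℤ) ^ n)) →
      (∃ v : HeightOneSpectrum (𝓞 ℚ), ((2 : ℕ) : 𝓞 ℚ) ∉ v.asIdeal ∧ ((W.conductorNorm ℤ : ℕ) : 𝓞 ℚ) ∈ v.asIdeal ∧ W.HasMultiplicativeReductionAt v) →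
      BSDp W 2 := by
  intro W _ _ _ hcm hr hSel hT hρ hv
  obtain ⟨K, iF, iN, ℓ₀, hK, hodd, h3, hH, hℓ₀, hd, hframe, Dt, β, ι, d₁, M₀, hc, hy, hdiv, hndiv, n, d, hn, hdeep, hPn⟩ :=
    hSupplyP W hcm hr hSel hT hρ hv
  obtain ⟨v, h2v, hNv, hmult⟩ := hv
  -- the twin model inside the budget (§2)
  have hD0 : (NumberField.discr K : ℚ) ≠ 0 := by exact_mod_cast NumberField.discr_ne_zero K
  haveI hTell : (W.quadraticTwist (NumberField.discr K : ℚ)).IsElliptic := W.isElliptic_quadraticTwist hD0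
  obtain ⟨Cd, hmin⟩ := hasGlobalMinimalModel_rat_holds (W.quadraticTwist (NumberField.discr K : ℚ))
  haveI := hmin
  have hbudget := genusBudget_of_primeFrame W hT hK hodd hH hℓ₀ hd hframe Cd rfl
  -- the twin model is non-CM (same `j`) of analytic rank `0` (Gross–Zagier), so `BSD₂(Wd)` by S1′
  obtain ⟨Ph, hPh, hPhmap⟩ := AdditiveKoly.exists_isHeegnerPoint_map_eq_derivedPoint_one (W := W) (K := K) (Dt := Dt) (β := β)
    (ι := ι) hK hH d₁
  have hPinf : ¬ IsOfFinAddOrder Ph := by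
    intro hfin
    apply hy
    rw [← hPhmap]
    exact (WeierstrassCurve.Affine.Point.map (W' := W) (algebraMap K (ringClassField K ι 1)).toRatAlgHom).isOfFinAddOrder hfin
  have hrT : (W.quadraticTwist (NumberField.discr K : ℚ)).analyticRank = 0 :=
    analyticRank_twist_eq_zero_of_rankOne W K (hGZ _ W K) hmod hK hH hr hPh hPinf
  have hcmd : ¬ (Cd • W.quadraticTwist (NumberField.discr K : ℚ)).HasCM := by
    rw [hasCM_iff_of_j_eq (((W.quadraticTwist (NumberField.discr K : ℚ)).variableChange_j Cd).trans (W.j_quadraticTwist hD0))]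
    exact hcm
  have hrd : (Cd • W.quadraticTwist (NumberField.discr K : ℚ)).analyticRank = 0 := by
    rw [analyticRank_smul]
    exact hrT
  exact bsdp_onOddCut_of_transpositionWitness_of_facts hQ2 hGZ hGZK hmod hMilneC W hcm hr hSel hT v h2v hNv hmult hρ K hK hodd h3 hH Dt hc β ι d₁ hy
    M₀ hdiv hndiv (Cd • W.quadraticTwist (NumberField.discr K : ℚ)) ⟨Cd, rfl⟩ hbudget (hS1 _ hcmd hrd) n d hn hdeep hPn

end Summit.BirchSwinnertonDyer.BirchSwinnertonDyer.Theorems.GenusExact.TwinSwap.TwinAnnihilation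

end
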